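import Mathlib
import HarnessLib
import Literature.NumberTheory.GaloisRepresentations.ResidualGaloisRep
import Literature.NumberTheory.GaloisRepresentations.DrigArtinianFunctor
import Literature.RepresentationTheory.Semisimple.Semisimplification
import Literature.RepresentationTheory.Semisimple.EquivOfCharacter
import Literature.RepresentationTheory.Semisimple.BrauerNesbitt
import Literature.RepresentationTheory.Semisimple.BurnsideMatrixSpan
import Literature.RepresentationTheory.Semisimple.IrreducibleOfCharpoly

/-!
# Stub `stub_residualIrreducibility` of crux `TensorSquareParallel` (stmt-Langlands-17009), helper 4:
# Kronecker (tensor) products of `GL₂`-valued homomorphisms — traces, integral models, reductions,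
# irreducibility

Glue between the matrix criterion of helper 2 (stability of subspaces of `M₂(k)` under
`X ↦ V X V'ᵀ`) and the tree's vocabulary of residual representations (`ResidualGaloisRep`):

* `charpoly_eq_of_trace_eq` — **in characteristic `0`, homomorphisms `G → GL_n(K)` with the
  same traces have the same characteristic polynomials** (semisimplify both,
  `exists_semisimplification`; equal characters give equivalent semisimplifications, the
  characteristic-zero Brauer–Nesbitt of the tree, `nonempty_equiv_of_character_eq_of_isSemisimple`;
  equivalent representations have equal characteristic polynomials);
* the Kronecker product `g ↦ V(g) ⊗ V'(g) ∈ GL₄` (the tree's `glKronecker`, used through a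
  hypothesis `∀ g, T g = glKronecker (V g) (V' g)` — no definition is introduced;
  `exists_kroneckerHom`): its trace is `tr V · tr V'`, an integral model / reduction of the factors
  gives one of the product (`isIntegralModelOf_kronecker`, `isReductionOf_kronecker`);
* `stub_residualIrreducibility_kronecker` — over an algebraically closed field, if the only
  subspaces of `M₂(k)` stable under `X ↦ V X V'ᵀ` are `0` and `M₂(k)`, then
  `T = V ⊗ V' : Λ → GL₄(k)` is absolutely irreducible (`M₂(k) ≅ k⁴` intertwines the two actions;
  Burnside for absolute irreducibility);
* `exists_not_mem_span_of_isIrreducible` — an irreducible `V : Λ → GL₂(k)` has no common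
  eigenvector.

## References

* [Calegari2010] F. Calegari, Invent. Math. 185 (2011), §2 (the tensor representation).
* [BourbakiAlgebreVIII2012] N. Bourbaki, *Algèbre* VIII, § 20 n° 6 (Brauer–Nesbitt; characters
  in characteristic `0`) — through the tree's `Literature.RepresentationTheory.Semisimple`.
* [DarmonDiamondTaylor1995] H. Darmon, F. Diamond, R. Taylor, *Fermat's Last Theorem*, §2.1
  (integral models and reductions) — through `ResidualGaloisRep`.
-/

set_option linter.dupNamespace false

noncomputable section

namespace Summit.Langlands.Langlands.Theorems.TensorSquareParallel

open scoped MatrixGroups Kronecker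
open Matrix Module IsLocalRing
open Literature.NumberTheory.GaloisRepresentations

universe u v

/-! ## Characteristic zero: traces determine characteristic polynomials -/

section CharZero

variable {K : Type u} [Field K] [CharZero K] {G : Type v} [Group G] {n : ℕ}

omit [CharZero K] in
/-- The character of the representation on `Kⁿ` through `σ` is the matrix trace. [folklore] -/
theorem character_glRepresentation (σ : G →* GL (Fin n) K) (g : G) :
    (glRepresentation σ).character g = ((σ g : GL (Fin n) K) : Matrix (Fin n) (Fin n) K).trace := by
  have e : ((glRepresentation σ) g : (Fin n → K) →ₗ[K] (Fin n → K)) =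
      Matrix.toLin' ((σ g : GL (Fin n) K) : Matrix (Fin n) (Fin n) K) :=
    LinearMap.ext fun v => by rw [Matrix.toLin'_apply]; rfl
  rw [Representation.character, e, Matrix.trace_toLin'_eq]

/-- **In characteristic zero, traces determine characteristic polynomials**: two homomorphisms
`σ, τ : G → GL_n(K)`, `char K = 0`, with `tr σ(g) = tr τ(g)` for all `g` have
`det(X − σ(g)) = det(X − τ(g))` for all `g`.  Proof: semisimplifications `σ^{ss}`, `τ^{ss}` (same
characteristic polynomials, hence same traces) have equal characters, so are equivalent by the
characteristic-zero Brauer–Nesbitt theorem, and equivalent representations have the same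
characteristic polynomials. [cite: BourbakiAlgebreVIII2012, VIII § 20 n° 6, Cor. a) de la Prop. 6 (pp. 375–376)] -/
theorem charpoly_eq_of_trace_eq (σ τ : G →* GL (Fin n) K)
    (h : ∀ g, ((σ g : GL (Fin n) K) : Matrix (Fin n) (Fin n) K).trace =
      ((τ g : GL (Fin n) K) : Matrix (Fin n) (Fin n) K).trace) (g : G) :
    ((σ g : GL (Fin n) K) : Matrix (Fin n) (Fin n) K).charpoly =
      ((τ g : GL (Fin n) K) : Matrix (Fin n) (Fin n) K).charpoly := by
  obtain ⟨σ', hσ', hσ'cp, -⟩ := Literature.RepresentationTheory.Semisimple.exists_semisimplification σ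
  obtain ⟨τ', hτ', hτ'cp, -⟩ := Literature.RepresentationTheory.Semisimple.exists_semisimplification τ
  haveI : (glRepresentation σ').IsSemisimpleRepresentation := hσ'
  haveI : (glRepresentation τ').IsSemisimpleRepresentation := hτ'
  have htr : ∀ (φ φ' : G →* GL (Fin n) K) (x : G),
      ((φ x : GL (Fin n) K) : Matrix (Fin n) (Fin n) K).charpoly =
        ((φ' x : GL (Fin n) K) : Matrix (Fin n) (Fin n) K).charpoly →
      ((φ x : GL (Fin n) K) : Matrix (Fin n) (Fin n) K).trace =
        ((φ' x : GL (Fin n) K) : Matrix (Fin n) (Fin n) K).trace := fun φ φ' x hx => by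
    rw [Matrix.trace_eq_neg_charpoly_nextCoeff, Matrix.trace_eq_neg_charpoly_nextCoeff, hx]
  have hchar : (glRepresentation σ').character = (glRepresentation τ').character := by
    funext x
    rw [character_glRepresentation, character_glRepresentation, htr σ' σ x (hσ'cp x),
      htr τ' τ x (hτ'cp x), h x]
  obtain ⟨e⟩ := Literature.RepresentationTheory.Semisimple.Representation.nonempty_equiv_of_character_eq_of_isSemisimple
    (glRepresentation σ') (glRepresentation τ') hchar
  have hcp := (Literature.RepresentationTheory.Semisimple.Representation.nonempty_equiv_iff_charpoly_eq
    (glRepresentation σ') (glRepresentation τ')).mp ⟨e⟩ g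
  rw [glRepresentation, glRepresentation, glStdRepresentation,
    Literature.RepresentationTheory.Semisimple.charpoly_ofDistribMulAction_comp_apply,
    Literature.RepresentationTheory.Semisimple.charpoly_ofDistribMulAction_comp_apply,
    hσ'cp, hτ'cp] at hcp
  exact hcp

end CharZero

/-! ## Kronecker products of `GL₂`-valued homomorphisms -/

section Kronecker

variable {A : Type u} [CommRing A] {G : Type v} [Group G]

/-- **The Kronecker product of two `GL₂`-valued homomorphisms is a `GL₄`-valued homomorphism**
`g ↦ V(g) ⊗ V'(g)` (existence form; `glKronecker_mul`). [folklore] -/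
theorem exists_kroneckerHom (V V' : G →* GL (Fin 2) A) :
    ∃ T : G →* GL (Fin (2 * 2)) A, ∀ g, T g = glKronecker (V g) (V' g) :=
  ⟨MonoidHom.mk' (fun g => glKronecker (V g) (V' g)) fun a b => by
    rw [map_mul, map_mul, glKronecker_mul], fun _ => rfl⟩

omit [Group G] in
/-- `tr (g ⊗ h) = tr g · tr h`. [folklore] -/
theorem trace_glKronecker (g h : GL (Fin 2) A) :
    ((glKronecker g h : GL (Fin (2 * 2)) A) : Matrix (Fin (2 * 2)) (Fin (2 * 2)) A).trace =
      ((g : GL (Fin 2) A) : Matrix (Fin 2) (Fin 2) A).trace *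
        ((h : GL (Fin 2) A) : Matrix (Fin 2) (Fin 2) A).trace := by
  rw [show ((glKronecker g h : GL (Fin (2 * 2)) A) : Matrix (Fin (2 * 2)) (Fin (2 * 2)) A) =
    Matrix.reindex finProdFinEquiv finProdFinEquiv
      ((g : Matrix (Fin 2) (Fin 2) A) ⊗ₖ (h : Matrix (Fin 2) (Fin 2) A)) from rfl]
  rw [← Matrix.trace_kronecker]
  simp only [Matrix.trace, Matrix.reindex_apply, Matrix.diag_apply, Matrix.submatrix_apply]
  exact Fintype.sum_equiv finProdFinEquiv.symm _ _ fun _ => rfl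

/-- **An integral model of the factors gives an integral model of the Kronecker product**:
if `V₀ = P⁻¹ V P`, `V₀' = P'⁻¹ V' P'` then `V₀ ⊗ V₀' = (P ⊗ P')⁻¹ (V ⊗ V') (P ⊗ P')`.
[cite: DarmonDiamondTaylor1995, §2.1, p. 54] -/
theorem isIntegralModelOf_kronecker {F : Type u} [Field F] {O : ValuationSubring F}
    {V V' : G →* GL (Fin 2) F} {V₀ V₀' : G →* GL (Fin 2) O}
    (h : IsIntegralModelOf V V₀) (h' : IsIntegralModelOf V' V₀')
    {T : G →* GL (Fin (2 * 2)) F} {T₀ : G →* GL (Fin (2 * 2)) O}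
    (hT : ∀ g, T g = glKronecker (V g) (V' g)) (hT₀ : ∀ g, T₀ g = glKronecker (V₀ g) (V₀' g)) :
    IsIntegralModelOf T T₀ := by
  obtain ⟨P, hP⟩ := h
  obtain ⟨P', hP'⟩ := h'
  refine ⟨glKronecker P P', fun g => ?_⟩
  rw [hT₀, map_glKronecker, hP g, hP' g, glKronecker_mul, glKronecker_mul, glKronecker_inv, hT]

/-- **Reduction commutes with Kronecker products**: the reduction of `V₀ ⊗ V₀'` is
`V̄₀ ⊗ V̄₀'`. [cite: DarmonDiamondTaylor1995, §2.1, p. 54] -/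
theorem integralReduction_kronecker {F : Type u} [Field F] {O : ValuationSubring F} {k : Type*}
    [Field k] (ι : ResidueField O →+* k) {V₀ V₀' : G →* GL (Fin 2) O} {T₀ : G →* GL (Fin (2 * 2)) O}
    (hT₀ : ∀ g, T₀ g = glKronecker (V₀ g) (V₀' g)) (g : G) :
    integralReduction ι T₀ g =
      glKronecker (integralReduction ι V₀ g) (integralReduction ι V₀' g) := by
  simp only [integralReduction, MonoidHom.comp_apply, hT₀]
  exact map_glKronecker _ _ _

/-- **A reduction of the Kronecker product**: if `V₀`, `V₀'` are integral models of `V`, `V'`,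
then `g ↦ V̄₀(g) ⊗ V̄₀'(g)` is a reduction of `V ⊗ V'`. [cite: DarmonDiamondTaylor1995, §2.1, p. 54 and Lemma 2.7] -/
theorem isReductionOf_kronecker {F : Type u} [Field F] {O : ValuationSubring F} {k : Type*}
    [Field k] (ι : ResidueField O →+* k) {V V' : G →* GL (Fin 2) F} {V₀ V₀' : G →* GL (Fin 2) O}
    (h : IsIntegralModelOf V V₀) (h' : IsIntegralModelOf V' V₀')
    {T : G →* GL (Fin (2 * 2)) F} (hT : ∀ g, T g = glKronecker (V g) (V' g))
    {Tb : G →* GL (Fin (2 * 2)) k}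
    (hTb : ∀ g, Tb g = glKronecker (integralReduction ι V₀ g) (integralReduction ι V₀' g)) :
    IsReductionOf ι T Tb := by
  obtain ⟨T₀, hT₀⟩ := exists_kroneckerHom V₀ V₀'
  refine ⟨T₀, 1, isIntegralModelOf_kronecker h h' hT hT₀, fun g => ?_⟩
  rw [one_mul, inv_one, mul_one, hTb, integralReduction_kronecker ι hT₀]

end Kronecker

/-! ## Irreducibility of `V ⊗ V'` from the matrix criterion -/

section Irreducible

variable {k : Type u} [Field k] {Λ : Type v} [Group Λ]

/-- **The Kronecker product acts on `k⁴ ≅ M₂(k)` by `X ↦ V X V'ᵀ`**: with the identification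
`e(X)_{(i,j)} = X_{ij}` (`Fin 2 × Fin 2 ≃ Fin 4` by `finProdFinEquiv`),
`(V ⊗ V') e(X) = e(V X V'ᵀ)`. [folklore] -/
theorem glKronecker_mulVec_uncurry (A B : GL (Fin 2) k) (X : Matrix (Fin 2) (Fin 2) k) :
    ((glKronecker A B : GL (Fin (2 * 2)) k) : Matrix (Fin (2 * 2)) (Fin (2 * 2)) k) *ᵥ
        (fun i => X ((finProdFinEquiv (m := 2) (n := 2)).symm i).1
          ((finProdFinEquiv (m := 2) (n := 2)).symm i).2) =
      fun i => ((A : Matrix (Fin 2) (Fin 2) k) * X * ((B : GL (Fin 2) k) : Matrix (Fin 2) (Fin 2) k)ᵀ)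
        ((finProdFinEquiv (m := 2) (n := 2)).symm i).1
        ((finProdFinEquiv (m := 2) (n := 2)).symm i).2 := by
  funext i
  simp only [Matrix.mulVec, dotProduct, coe_glKronecker, Matrix.reindex_apply,
    Matrix.submatrix_apply, Matrix.kroneckerMap_apply, Matrix.mul_apply, Matrix.transpose_apply]
  rw [← Equiv.sum_comp (finProdFinEquiv (m := 2) (n := 2))]
  simp only [Equiv.symm_apply_apply, Fintype.sum_prod_type]
  rw [Finset.sum_comm]
  refine Finset.sum_congr rfl fun b _ => ?_
  rw [Finset.sum_mul]
  refine Finset.sum_congr rfl fun a _ => ?_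
  ring

/-- **Irreducibility of the Kronecker product from the matrix criterion** (the registered
sub-goal this helper file proves): over an algebraically closed field `k`, if the only subspaces
of `M₂(k)` stable under `X ↦ V(λ) X V'(λ)ᵀ` are `0` and `M₂(k)`, then
`T = V ⊗ V' : Λ → GL₄(k)` is absolutely irreducible: a stable subspace of `k⁴` pulls back along
`M₂(k) ≅ k⁴` to a stable subspace of `M₂(k)`, and over an algebraically closed field
irreducibility is absolute irreducibility (Burnside, the tree's
`span_eq_top_iff_forall_isIrreducible`). [folklore] -/
theorem stub_residualIrreducibility_kronecker : ∀ (k : Type) [Field k] [IsAlgClosed k] (Λ : Type) [Group Λ] (V V' : Λ →* GL (Fin 2) k) (T : Λ →* GL (Fin (2 * 2)) k), (∀ x, T x = Literature.NumberTheory.GaloisRepresentations.glKronecker (V x) (V' x)) → (∀ W : Submodule k (Matrix (Fin 2) (Fin 2) k), (∀ x, ∀ X ∈ W, (V x).val * X * (V' x).val.transpose ∈ W) → W = ⊥ ∨ W = ⊤) → Literature.NumberTheory.GaloisRepresentations.IsAbsIrreducible T := by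
  intro k _ _ Λ _ V V' T hT hW
  -- the identification `e : M₂(k) ≃ k⁴`
  let e : Matrix (Fin 2) (Fin 2) k ≃ₗ[k] (Fin (2 * 2) → k) :=
    (LinearEquiv.curry k k (Fin 2) (Fin 2)).symm ≪≫ₗ
      LinearEquiv.funCongrLeft k k (finProdFinEquiv (m := 2) (n := 2)).symm
  have he : ∀ X : Matrix (Fin 2) (Fin 2) k,
      e X = fun i => X ((finProdFinEquiv (m := 2) (n := 2)).symm i).1
        ((finProdFinEquiv (m := 2) (n := 2)).symm i).2 := fun X => rfl
  -- irreducibility over `k`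
  have hirr : (glRepresentation T).IsIrreducible := by
    have hbot : (⊥ : Subrepresentation (glRepresentation T)).toSubmodule = ⊥ := rfl
    have htop : (⊤ : Subrepresentation (glRepresentation T)).toSubmodule = ⊤ := rfl
    refine { toNontrivial := ⟨⟨⊥, ⊤, fun hbt => ?_⟩⟩, eq_bot_or_eq_top := fun W' => ?_ }
    · have h' : (⊥ : Submodule k (Fin (2 * 2) → k)) = ⊤ := by
        rw [← hbot, ← htop, hbt]
      exact bot_ne_top h'
    · -- pull back along `e`
      set W : Submodule k (Matrix (Fin 2) (Fin 2) k) := W'.toSubmodule.comap e.toLinearMap with hWdef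
      have hWstab : ∀ x, ∀ X ∈ W, ((V x : GL (Fin 2) k) : Matrix (Fin 2) (Fin 2) k) * X *
          ((V' x : GL (Fin 2) k) : Matrix (Fin 2) (Fin 2) k)ᵀ ∈ W := by
        intro x X hX
        change e _ ∈ W'.toSubmodule
        have hX' : e X ∈ W'.toSubmodule := hX
        have := W'.apply_mem_toSubmodule x hX'
        rw [glRepresentation_apply_apply, hT x, he, glKronecker_mulVec_uncurry] at this
        rw [he]
        exact this
      rcases hW W hWstab with h0 | h1
      · left
        apply Subrepresentation.toSubmodule_injective
        rw [hbot, eq_bot_iff]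
        intro v hv
        have : e.symm v ∈ W := by
          change e (e.symm v) ∈ W'.toSubmodule
          rw [LinearEquiv.apply_symm_apply]; exact hv
        rw [h0, Submodule.mem_bot] at this
        rw [Submodule.mem_bot, ← e.apply_symm_apply v, this, map_zero]
      · right
        apply Subrepresentation.toSubmodule_injective
        rw [htop, eq_top_iff]
        intro v _
        have : e.symm v ∈ W := by rw [h1]; exact Submodule.mem_top
        change e (e.symm v) ∈ W'.toSubmodule at this
        rwa [LinearEquiv.apply_symm_apply] at this
  -- absolute irreducibility (Burnside over the algebraically closed `k`)
  haveI := hirr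
  have hspan := Literature.RepresentationTheory.Semisimple.span_eq_top_of_isIrreducible T
  exact (Literature.RepresentationTheory.Semisimple.span_eq_top_iff_forall_isIrreducible
    (by norm_num) T).mp hspan

/-- **An irreducible `V : Λ → GL₂(k)` has no common eigenvector** (a common eigenvector spans a
stable line, a proper non-zero subrepresentation of `k²`). [folklore] -/
theorem exists_not_mem_span_of_isIrreducible (V : Λ →* GL (Fin 2) k)
    (hirr : (glRepresentation V).IsIrreducible) (v : Fin 2 → k) (hv : v ≠ 0) :
    ∃ x, ((V x : GL (Fin 2) k) : Matrix (Fin 2) (Fin 2) k) *ᵥ v ∉ k ∙ v := by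
  by_contra hall
  push Not at hall
  let W : Subrepresentation (glRepresentation V) :=
    { toSubmodule := k ∙ v
      apply_mem_toSubmodule := fun x w hw => by
        obtain ⟨a, rfl⟩ := Submodule.mem_span_singleton.mp hw
        rw [map_smul, glRepresentation_apply_apply]
        exact Submodule.smul_mem _ _ (hall x) }
  haveI := hirr
  have hbot : (⊥ : Subrepresentation (glRepresentation V)).toSubmodule = ⊥ := rfl
  have htop : (⊤ : Subrepresentation (glRepresentation V)).toSubmodule = ⊤ := rfl
  rcases eq_bot_or_eq_top W with h | h
  · have : (k ∙ v) = ⊥ := by rw [← hbot, ← h]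
    exact hv ((Submodule.span_singleton_eq_bot).mp this)
  · have h2 : finrank k (k ∙ v) = finrank k (⊤ : Submodule k (Fin 2 → k)) := by
      rw [← htop, ← h]
    rw [finrank_span_singleton hv, finrank_top, Module.finrank_fin_fun] at h2
    exact absurd h2 (by norm_num)

/-- No common eigenvector is a property of the image: it passes from `V` to any `V'` with
`V(Λ) ⊆ V'(Λ')`. [folklore] -/
theorem exists_not_mem_span_of_range_le {Λ' : Type*} [Group Λ'] {V : Λ →* GL (Fin 2) k}
    {V' : Λ' →* GL (Fin 2) k}
    (hV : ∀ v : Fin 2 → k, v ≠ 0 → ∃ x, ((V x : GL (Fin 2) k) : Matrix (Fin 2) (Fin 2) k) *ᵥ v ∉ k ∙ v)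
    (h : V.range ≤ V'.range) (v : Fin 2 → k) (hv : v ≠ 0) :
    ∃ y, ((V' y : GL (Fin 2) k) : Matrix (Fin 2) (Fin 2) k) *ᵥ v ∉ k ∙ v := by
  obtain ⟨x, hx⟩ := hV v hv
  obtain ⟨y, hy⟩ := h ⟨x, rfl⟩
  exact ⟨y, by rw [hy]; exact hx⟩

end Irreducible

end Summit.Langlands.Langlands.Theorems.TensorSquareParallel

end
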